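import Literature.NumberTheory.DiophantineGeometry.GLHighestWeightIsomorphismProofs
import Mathlib.LinearAlgebra.Matrix.Permutation
import HarnessLib

/-!
# Highest-weight vectors of constant (rectangular) weight are `det^c`-semi-invariants

Topic `Literature/RepresentationTheory/GeneralLinear`; theorems only (no public definitions, no
named facts). The classical fact behind "the `SL_m`-invariants of degree `d` on `Sym^D ℂ^m` are
the highest-weight vectors of the rectangular weight `m × (Dd/m)`" (P. Bürgisser, C. Ikenmeyer,
*Fundamental invariants of orbit closures*, J. Algebra 477 (2017), Rem. 3.13 / §3.1; W. Fulton,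
J. Harris, *Representation Theory*, GTM 129, §15.5: the irreducible representation of `GL_n` with
highest weight `(c, …, c)` is the character `det^c`): in a RATIONAL representation `ρ` of
`GL_n(k)` (`IsRationalRep`, `k` an infinite field) a `B`-semi-invariant `v` of a CONSTANT weight
`χ = (c, …, c)` — `ρ(b) v = det(b)^c v` for all upper triangular `b` — satisfies
`ρ(g) v = det(g)^c v` for EVERY `g ∈ GL_n(k)` (`apply_eq_det_zpow_smul_of_mem_highestWeightSpace_const`);
in particular it is fixed by every `g` of determinant `1`.

## Proof (elementary, on the tree's big-cell machinery of `GLHighestWeightIsomorphismProofs`)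

1. `G · v ⊆ span (U⁻ · v)` for a highest-weight vector `v` of a rational representation
   (`apply_mem_lowerSpan`, density of the big cell `U⁻ B`).
2. The permutation matrix `w₀` of the order reversal maps `v` to a TORUS weight vector of the
   permuted weight `χ ∘ w₀ = χ` (constant!), which lies in `span (U⁻ · v)` by 1; the weight-`χ` part
   of `span (U⁻ · v)` is the line `k v` (`exists_eq_smul_of_mem_lowerSpan_of_mem_weightSpace`, the
   group version of `dim V(λ) = 1`), so `ρ(w₀) v = a v` with `a² = 1`.
3. Conjugation by `w₀` swaps `U⁻` and `U⁺`: for a lower unitriangular `u`, `w₀ u w₀` is upper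
   unitriangular, on which the character `χ` is `1`; hence `ρ(u) v = ρ(w₀) ρ(w₀ u w₀) ρ(w₀) v = v` —
   `v` is `U⁻`-invariant, `span (U⁻ · v) = k v`, and by 1 the line `k v` is `G`-stable.
4. On the big cell `g = u b` the eigenvalue is `χ(b) = det(b)^c = det(g)^c`; a matrix coefficient of
   a rational representation is `P(g)/det(g)^r`, and the polynomial identity
   `P · det^{c⁻} = φ(v) · det^{c⁺ + r}` holds on the dense big cell, hence everywhere
   (`eq_zero_of_eval_eq_zero_of_leadMinor_ne_zero`).

HONEST FRAMING: infrastructure for the bookkeeping of classical invariant theory in the cell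
`val-lit` (BI 2017 Ex. 3.7); nothing here bears on permanent versus determinant or VP versus VNP.

## References
* [FultonHarrisGTM129] W. Fulton, J. Harris, *Representation Theory. A First Course*, GTM 129
  (1991), §15.5 (irreducible representations of `GL_n ℂ`; `Γ_{(c,…,c)} = det^c`; Thm. 15.47).
* [BurgisserIkenmeyer2017] P. Bürgisser, C. Ikenmeyer, J. Algebra 477 (2017), Rem. 3.13.
* [SpringerLAG1998] T. A. Springer, *Linear Algebraic Groups*, 8.3.11 (density of the big cell).

## Tree
`highestWeightSpace`, `weightSpace`, `weightChar`, `IsUpperTriangular`, `IsDiagonalGL`,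
`isDiagonalGL_iff_isDiag`, `IsRationalRep` (`GLHighestWeight`); `lowerUnitri`, `lowerUnitriMatrix`,
`lowerUnitriMatrix_apply_self/_of_gt`, `coe_lowerUnitri`, `det_coe_lowerUnitri`, `lowerSpan`,
`apply_mem_lowerSpan`, `exists_eq_smul_of_mem_lowerSpan_of_mem_weightSpace`,
`exists_eq_lowerUnitri_mul_of_leadMinor_ne_zero`, `eq_zero_of_eval_eq_zero_of_leadMinor_ne_zero`
(`GLHighestWeightIsomorphismProofs`). Mathlib: `Equiv.Perm.permMatrix`, `Matrix.permMatrix_mul`,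
`PEquiv.toMatrix_toPEquiv_mul`, `PEquiv.mul_toMatrix_toPEquiv`, `Matrix.det_of_upperTriangular`,
`Finset.prod_zpow`, `Matrix.mvPolynomialX`, `Module.forall_dual_apply_eq_zero_iff`.

Provenance: val-lit cell, prover val-lit-p4 g4 (towards `BI2017_ex_3_7`).
-/

noncomputable section

open scoped BigOperators Matrix MatrixGroups
open MvPolynomial Matrix

namespace Literature.NumberTheory.DiophantineGeometry

variable {n : ℕ} {k : Type*} [Field k]
variable {V : Type*} [AddCommGroup V] [Module k V]

/-! ### §1 The constant weight and its character -/

/-- The character of the constant weight `(c, …, c)` on an upper triangular matrix is `det^c`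
(the determinant of a triangular matrix is the product of its diagonal). Fulton–Harris §15.5.
[cite: FultonHarrisGTM129, §15.5] -/
theorem weightChar_const_of_isUpperTriangular {σ : Type*} [Fintype σ] [LinearOrder σ] (c : ℤ)
    {g : GL σ k} (hg : IsUpperTriangular g) :
    weightChar (fun _ : σ => c) g = (g : Matrix σ σ k).det ^ c := by
  simp only [weightChar]
  rw [Finset.prod_zpow, ← Matrix.det_of_upperTriangular hg]

/-- The character of the constant weight is `1` on a matrix with unit diagonal.
Fulton–Harris §15.5. [cite: FultonHarrisGTM129, §15.5] -/
theorem weightChar_const_eq_one_of_diag_eq_one {σ : Type*} [Fintype σ] [LinearOrder σ] (c : ℤ)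
    {g : GL σ k} (hdiag : ∀ i, (g : Matrix σ σ k) i i = 1) :
    weightChar (fun _ : σ => c) g = 1 := by
  simp only [weightChar]
  exact Finset.prod_eq_one fun i _ => by rw [hdiag i, one_zpow]

/-! ### §2 The order-reversing permutation matrix -/

/-- There is an element `w₀ ∈ GL_n(k)` (the permutation matrix of the order reversal of `Fin n`)
with `w₀ w₀ = 1` and `(w₀ M w₀)_{ij} = M_{w₀ i, w₀ j}` for every matrix `M`. [folklore] -/
private theorem exists_revGL : ∃ R : GL (Fin n) k, R * R = 1 ∧
    ∀ (M : Matrix (Fin n) (Fin n) k) (i j : Fin n),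
      ((R : Matrix (Fin n) (Fin n) k) * M * (R : Matrix (Fin n) (Fin n) k)) i j =
        M (Fin.rev i) (Fin.rev j) := by
  have hsq : (Fin.revPerm : Equiv.Perm (Fin n)).permMatrix k *
      (Fin.revPerm : Equiv.Perm (Fin n)).permMatrix k = 1 := by
    rw [← Matrix.permMatrix_mul, show (Fin.revPerm * Fin.revPerm : Equiv.Perm (Fin n)) = 1 from
      Equiv.ext fun i => by simp [Equiv.Perm.mul_apply], Matrix.permMatrix_one]
  refine ⟨⟨_, _, hsq, hsq⟩, Units.ext hsq, fun M i j => ?_⟩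
  change ((((Fin.revPerm : Equiv.Perm (Fin n)).toPEquiv.toMatrix : Matrix (Fin n) (Fin n) k) * M) *
    ((Fin.revPerm : Equiv.Perm (Fin n)).toPEquiv.toMatrix : Matrix (Fin n) (Fin n) k)) i j = _
  rw [PEquiv.toMatrix_toPEquiv_mul, PEquiv.mul_toMatrix_toPEquiv]
  rfl

section RevLemmas

variable {R : GL (Fin n) k}
  (hconj : ∀ (M : Matrix (Fin n) (Fin n) k) (i j : Fin n),
    ((R : Matrix (Fin n) (Fin n) k) * M * (R : Matrix (Fin n) (Fin n) k)) i j = M (Fin.rev i) (Fin.rev j))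
include hconj

/-- The conjugate of a diagonal element of `GL_n` by `w₀` is diagonal. [folklore] -/
private theorem isDiagonalGL_revGL_conj {t : GL (Fin n) k} (ht : IsDiagonalGL t) :
    IsDiagonalGL (R * t * R) := by
  rw [isDiagonalGL_iff_isDiag] at ht ⊢
  intro i j hij
  rw [Units.val_mul, Units.val_mul, hconj]
  exact ht fun h => hij (Fin.rev_injective h)

/-- The character of a CONSTANT weight is invariant under conjugation by `w₀` (the diagonal is
permuted). [folklore] -/
private theorem weightChar_const_revGL_conj (c : ℤ) (t : GL (Fin n) k) :
    weightChar (fun _ : Fin n => c) (R * t * R) = weightChar (fun _ : Fin n => c) t := by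
  simp only [weightChar]
  have h : ∀ i : Fin n, ((R * t * R : GL (Fin n) k) : Matrix (Fin n) (Fin n) k) i i =
      (t : Matrix (Fin n) (Fin n) k) (Fin.rev i) (Fin.rev i) := fun i => by
    rw [Units.val_mul, Units.val_mul]
    exact hconj _ i i
  simp only [h]
  exact Fintype.prod_equiv Fin.revPerm _ _ fun i => rfl

/-- For a lower unitriangular `u = u(a)`, the conjugate `w₀ u w₀` is upper triangular with unit
diagonal. [folklore] -/
private theorem isUpperTriangular_revGL_conj_lowerUnitri (a : LowIdx (Fin n) → k) :
    IsUpperTriangular (R * lowerUnitri a * R) ∧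
      ∀ i, ((R * lowerUnitri a * R : GL (Fin n) k) : Matrix (Fin n) (Fin n) k) i i = 1 := by
  have h : ∀ i j : Fin n,
      ((R * lowerUnitri a * R : GL (Fin n) k) : Matrix (Fin n) (Fin n) k) i j =
        lowerUnitriMatrix a (Fin.rev i) (Fin.rev j) := fun i j => by
    rw [Units.val_mul, Units.val_mul, coe_lowerUnitri]
    exact hconj _ i j
  refine ⟨fun i j hij => ?_, fun i => ?_⟩
  · change ((R * lowerUnitri a * R : GL (Fin n) k) : Matrix (Fin n) (Fin n) k) i j = 0
    rw [h]
    exact lowerUnitriMatrix_apply_of_gt a (Fin.rev_lt_rev.mpr hij)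
  · rw [h, lowerUnitriMatrix_apply_self]

end RevLemmas

/-! ### §3 `U⁻`-invariance and the `G`-stable line -/

section Line

variable [Infinite k] {ρ : Representation k (GL (Fin n) k) V} {c : ℤ} {v : V}

omit [Infinite k] in
/-- **Step 2**: `ρ(w₀) v` is a torus weight vector of the (constant) weight of `v`. [folklore] -/
private theorem apply_revGL_mem_weightSpace {R : GL (Fin n) k} (hRR : R * R = 1)
    (hconj : ∀ (M : Matrix (Fin n) (Fin n) k) (i j : Fin n),
      ((R : Matrix (Fin n) (Fin n) k) * M * (R : Matrix (Fin n) (Fin n) k)) i j = M (Fin.rev i) (Fin.rev j))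
    (hv : v ∈ highestWeightSpace ρ (fun _ => c)) :
    ρ R v ∈ weightSpace ρ (fun _ => c) := by
  have hvw := highestWeightSpace_le_weightSpace _ _ hv
  intro t ht
  -- `t w₀ = w₀ (w₀ t w₀)`
  have hc : t * R = R * (R * t * R) := by
    rw [mul_assoc, ← mul_assoc R R, hRR, one_mul]
  rw [← Module.End.mul_apply, ← map_mul, hc, map_mul, Module.End.mul_apply,
    hvw _ (isDiagonalGL_revGL_conj hconj ht), map_smul, weightChar_const_revGL_conj hconj]

/-- **A highest-weight vector of constant weight is fixed by the lower unitriangular matrices**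
(step 3: `ρ(u) v = ρ(w₀) ρ(w₀ u w₀) ρ(w₀) v`, `w₀ u w₀` is upper unitriangular, and
`ρ(w₀) v = a v` with `a² = 1` by the weight-`χ` line of `span (U⁻ · v)`).
[cite: FultonHarrisGTM129, §15.5] -/
theorem apply_lowerUnitri_eq_self_of_mem_highestWeightSpace_const (hρ : IsRationalRep ρ)
    (hv : v ∈ highestWeightSpace ρ (fun _ => c)) (a : LowIdx (Fin n) → k) :
    ρ (lowerUnitri a) v = v := by
  obtain ⟨R, hRR, hconj⟩ := exists_revGL (n := n) (k := k)
  -- step 2': `ρ(w₀) v = a₀ • v`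
  obtain ⟨a₀, ha₀⟩ : ∃ a₀ : k, ρ R v = a₀ • v :=
    exists_eq_smul_of_mem_lowerSpan_of_mem_weightSpace hρ (highestWeightSpace_le_weightSpace _ _ hv)
      (apply_mem_lowerSpan hρ hv _) (apply_revGL_mem_weightSpace hRR hconj hv)
  by_cases hv0 : v = 0
  · rw [hv0, map_zero]
  -- `a₀² = 1` since `w₀² = 1`
  have hsq : a₀ * a₀ = 1 := by
    have h2 : ρ R (ρ R v) = v := by
      rw [← Module.End.mul_apply, ← map_mul, hRR, map_one, Module.End.one_apply]
    rw [ha₀, map_smul, ha₀, smul_smul] at h2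
    by_contra hne
    have h3 : (a₀ * a₀ - 1) • v = 0 := by rw [sub_smul, one_smul, h2, sub_self]
    rcases smul_eq_zero.mp h3 with h4 | h4
    · exact hne (sub_eq_zero.mp h4)
    · exact hv0 h4
  obtain ⟨hB, hdiag⟩ := isUpperTriangular_revGL_conj_lowerUnitri hconj a
  -- `u = w₀ (w₀ u w₀) w₀`
  have hu : R * (R * lowerUnitri a * R) * R = lowerUnitri a := by
    simp only [← mul_assoc]
    rw [hRR, one_mul, mul_assoc, hRR, mul_one]
  rw [← hu, map_mul, map_mul, Module.End.mul_apply, Module.End.mul_apply, ha₀, map_smul,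
    hv _ hB, weightChar_const_eq_one_of_diag_eq_one c hdiag, one_smul, map_smul, ha₀, smul_smul, hsq,
    one_smul]

/-- **The line `k v` is `G`-stable**: `ρ(g) v ∈ k ∙ v` for every `g` (`span (U⁻ · v) = k v` and
`G · v ⊆ span (U⁻ · v)`). [cite: FultonHarrisGTM129, §15.5] -/
theorem apply_mem_span_singleton_of_mem_highestWeightSpace_const (hρ : IsRationalRep ρ)
    (hv : v ∈ highestWeightSpace ρ (fun _ => c)) (g : GL (Fin n) k) :
    ρ g v ∈ k ∙ v := by
  have hle : lowerSpan ρ v ≤ k ∙ v := by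
    refine Submodule.span_le.mpr ?_
    rintro _ ⟨a, rfl⟩
    change ρ (lowerUnitri a) v ∈ k ∙ v
    rw [apply_lowerUnitri_eq_self_of_mem_highestWeightSpace_const hρ hv a]
    exact Submodule.mem_span_singleton_self v
  exact hle (apply_mem_lowerSpan hρ hv g)

end Line

/-! ### §4 The character of the line is `det^c` -/

section Character

variable [Infinite k] {ρ : Representation k (GL (Fin n) k) V} {c : ℤ} {v : V}

/-- On the big cell the eigenvalue is `det(g)^c`: `ρ(u b) v = det(u b)^c • v`. [folklore] -/
private theorem apply_eq_det_zpow_smul_of_bigCell (hρ : IsRationalRep ρ)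
    (hv : v ∈ highestWeightSpace ρ (fun _ => c)) {g b : GL (Fin n) k} {a : LowIdx (Fin n) → k}
    (hb : IsUpperTriangular b) (hg : g = lowerUnitri a * b) :
    ρ g v = ((g : Matrix (Fin n) (Fin n) k).det ^ c) • v := by
  rw [hg, map_mul, Module.End.mul_apply, hv b hb, map_smul,
    apply_lowerUnitri_eq_self_of_mem_highestWeightSpace_const hρ hv a,
    weightChar_const_of_isUpperTriangular c hb, Units.val_mul, Matrix.det_mul, det_coe_lowerUnitri,
    one_mul]

/-- **A highest-weight vector of constant weight `(c,…,c)` in a rational representation of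
`GL_n(k)` (`k` infinite) is a `det^c`-semi-invariant: `ρ(g) v = det(g)^c • v` for all `g`.**
(The irreducible representation of highest weight `(c,…,c)` is the character `det^c`,
Fulton–Harris §15.5; here for an arbitrary rational representation, via the density of the big
cell.) [cite: FultonHarrisGTM129, §15.5] -/
theorem apply_eq_det_zpow_smul_of_mem_highestWeightSpace_const (hρ : IsRationalRep ρ)
    (hv : v ∈ highestWeightSpace ρ (fun _ => c)) (g : GL (Fin n) k) :
    ρ g v = ((g : Matrix (Fin n) (Fin n) k).det ^ c) • v := by
  classical
  -- test against linear forms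
  rw [← sub_eq_zero]
  refine (Module.forall_dual_apply_eq_zero_iff k _).mp fun φ => ?_
  rw [map_sub, map_smul, smul_eq_mul, sub_eq_zero]
  obtain ⟨P, r, hP⟩ := hρ v φ
  -- the generic matrix and the evaluation of `det` powers
  set Y : Matrix (Fin n) (Fin n) (MvPolynomial (Fin n × Fin n) k) := mvPolynomialX (Fin n) (Fin n) k
    with hY
  have hYmap : ∀ x : Fin n × Fin n → k, Y.map (eval x) = Matrix.of fun i j => x (i, j) := by
    intro x
    ext i j
    simp [hY, mvPolynomialX]
  have hevaldet : ∀ (g' : GL (Fin n) k) (e : ℕ),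
      eval (fun ij : Fin n × Fin n => (g' : Matrix (Fin n) (Fin n) k) ij.1 ij.2) (Y.det ^ e) =
        (g' : Matrix (Fin n) (Fin n) k).det ^ e := by
    intro g' e
    rw [map_pow, RingHom.map_det, RingHom.mapMatrix_apply, hYmap]
    rfl
  have hdet0 : ∀ g' : GL (Fin n) k, (g' : Matrix (Fin n) (Fin n) k).det ≠ 0 :=
    fun g' => Matrix.GeneralLinearGroup.det_ne_zero g'
  -- `c = c⁺ - c⁻`, `det^c = det^{c⁺} (det^{c⁻})⁻¹`
  have hcsplit : (c.toNat : ℤ) - ((-c).toNat : ℤ) = c := by omega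
  have hzpow : ∀ g' : GL (Fin n) k, (g' : Matrix (Fin n) (Fin n) k).det ^ c =
      (g' : Matrix (Fin n) (Fin n) k).det ^ c.toNat *
        ((g' : Matrix (Fin n) (Fin n) k).det ^ (-c).toNat)⁻¹ := by
    intro g'
    conv_lhs => rw [← hcsplit]
    rw [zpow_sub₀ (hdet0 g'), zpow_natCast, zpow_natCast, div_eq_mul_inv]
  -- the polynomial identity `P · det^{c⁻} = φ(v) · det^{c⁺ + r}` on the big cell, hence everywhere
  set Q : MvPolynomial (Fin n × Fin n) k :=
    P * Y.det ^ (-c).toNat - C (φ v) * Y.det ^ (c.toNat + r) with hQ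
  have hQ0 : Q = 0 := by
    refine eq_zero_of_eval_eq_zero_of_leadMinor_ne_zero Q fun g' hg' => ?_
    obtain ⟨a, b, hb, hg'eq⟩ := exists_eq_lowerUnitri_mul_of_leadMinor_ne_zero g' hg'
    have hval : φ (ρ g' v) = (g' : Matrix (Fin n) (Fin n) k).det ^ c * φ v := by
      rw [apply_eq_det_zpow_smul_of_bigCell hρ hv hb hg'eq, map_smul, smul_eq_mul]
    have hm' : (g' : Matrix (Fin n) (Fin n) k).det ^ (-c).toNat ≠ 0 := pow_ne_zero _ (hdet0 g')
    have hinv : ((g' : Matrix (Fin n) (Fin n) k).det ^ (-c).toNat)⁻¹ *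
        (g' : Matrix (Fin n) (Fin n) k).det ^ (-c).toNat = 1 := inv_mul_cancel₀ hm'
    rw [hQ, map_sub, map_mul, map_mul, hevaldet, hevaldet, eval_C, ← hP g', hval, hzpow, pow_add]
    linear_combination
      ((g' : Matrix (Fin n) (Fin n) k).det ^ c.toNat * φ v * (g' : Matrix (Fin n) (Fin n) k).det ^ r) * hinv
  -- read the identity off at `g`
  have h := congrArg (eval fun ij : Fin n × Fin n => (g : Matrix (Fin n) (Fin n) k) ij.1 ij.2) hQ0
  rw [hQ, map_sub, map_zero, sub_eq_zero, map_mul, map_mul, hevaldet, hevaldet, eval_C, ← hP g,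
    pow_add] at h
  -- `φ(ρ g v) det^r det^{c⁻} = φ v det^{c⁺} det^r`
  have hr : (g : Matrix (Fin n) (Fin n) k).det ^ r ≠ 0 := pow_ne_zero _ (hdet0 g)
  have hm : (g : Matrix (Fin n) (Fin n) k).det ^ (-c).toNat ≠ 0 := pow_ne_zero _ (hdet0 g)
  have h' : φ (ρ g v) * (g : Matrix (Fin n) (Fin n) k).det ^ (-c).toNat =
      φ v * (g : Matrix (Fin n) (Fin n) k).det ^ c.toNat := by
    apply mul_right_cancel₀ hr
    linear_combination h
  rw [hzpow]
  calc φ (ρ g v)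
      = φ (ρ g v) * (g : Matrix (Fin n) (Fin n) k).det ^ (-c).toNat *
          ((g : Matrix (Fin n) (Fin n) k).det ^ (-c).toNat)⁻¹ := by
        rw [mul_assoc, mul_inv_cancel₀ hm, mul_one]
    _ = φ v * (g : Matrix (Fin n) (Fin n) k).det ^ c.toNat *
          ((g : Matrix (Fin n) (Fin n) k).det ^ (-c).toNat)⁻¹ := by rw [h']
    _ = (g : Matrix (Fin n) (Fin n) k).det ^ c.toNat *
          ((g : Matrix (Fin n) (Fin n) k).det ^ (-c).toNat)⁻¹ * φ v := by ring

/-- In particular such a vector is fixed by every `g` of determinant `1`.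
[cite: FultonHarrisGTM129, §15.5] -/
theorem apply_eq_self_of_mem_highestWeightSpace_const_of_det_eq_one (hρ : IsRationalRep ρ)
    (hv : v ∈ highestWeightSpace ρ (fun _ => c)) {g : GL (Fin n) k}
    (hg : (g : Matrix (Fin n) (Fin n) k).det = 1) : ρ g v = v := by
  rw [apply_eq_det_zpow_smul_of_mem_highestWeightSpace_const hρ hv g, hg, one_zpow, one_smul]

end Character

end Literature.NumberTheory.DiophantineGeometry

end
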